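import Summits.Ventures.CertifiedManyBodySolver.Downfold.GridCosineArcs
import HarnessLib

/-!
# The direct one-band in-plane band, VI: HARMONIC integer enclosures of the band and of its momentum derivative on a
# block of grid cells, and the first-order (mean-value) CELL ENCLOSURE

Venture CertifiedManyBodySolver, cell `pub/hubbard-downfold` (stage S1, technique B), seat hubbard-downfold-mod-4 (g25);
namespace `Summit.Ventures.CertifiedManyBodySolver.Downfold.Emery`. Everything here is PROVED; no number lives here.
WHAT THIS IS NOT: a statement about any material; `U = 0` one-body kinematics of a one-band Wannier Hamiltonian.

Layer 2 of the g25 CELL-TREE device (premise-free filling certificates — no monotonicity of the band is assumed, so the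
extended-saddle class of `hr.dat` legs is covered). For the band `ε(k) = Σ_s h_s·star_s(k)` of `OneBandInPlane` (shell
list `S`, stars in `cos(m kx), cos(n ky)`) and a block of grid cells `[k_{a0}, k_{a1}] × [k_{b0}, k_{b1}]` of the
`K`-grid:

* §1 the `kx`-derivative in harmonic form `ipBandDx` (`hasDerivAt_ipBandK_kx'`; `ky` by the symmetry `ipBandK_comm`);
* §2 integer intervals at a fixed scale: `ZEncl lo hi x`, Moore product `zmulLo/Hi`, signed scaling `zscale`;
* §3 the harmonic enclosures at scale `10¹⁸·10⁶`: arcs of `cos(m·)` / `sin(m·)` for `m = 1 … 4` computed ONCE per block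
  (`arcs4`, `sarcs4`, trivial enclosure beyond), stars `starEnclZ`, `dstarEnclZ`, band `bandEnclZ`, derivative `dbandEnclZ`
  — soundness `bandEnclZ_sound`, `dbandEnclZ_sound` (integer arithmetic only: kernel-fast);
* the CELL ENCLOSURE (mean-value form) built on these is in the companion file `OneBandCellEnclosure`.

Sources: interval ranges and the mean-value (centred) form [Moore1966, §3.2, Theorem 3.1, §4.4]; one-band `t–t′–t″…` form
[AndersenEtAl1995, §6].
-/

noncomputable section

namespace Summit.Ventures.CertifiedManyBodySolver.Downfold.Emery

open Real Set

/-! ## §1 The momentum derivative of the band in harmonic form -/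

/-- `∂/∂kx` of the star of the shell `(m, n)`. [folklore] -/
def dstarKx (m n : ℕ) (kx ky : ℝ) : ℝ :=
  if n = 0 then (if m = 0 then 0 else 2 * (-(m : ℝ) * sin (m * kx)))
  else if m = n then 4 * (-(m : ℝ) * sin (m * kx) * cos (m * ky))
  else 4 * (-(m : ℝ) * sin (m * kx) * cos (n * ky) + -(n : ℝ) * sin (n * kx) * cos (m * ky))

/-- `d/dk cos(m k) = −m sin(m k)`. [folklore] -/
theorem hasDerivAt_cos_natMul (m : ℕ) (k : ℝ) : HasDerivAt (fun k => cos (m * k)) (-(m : ℝ) * sin (m * k)) k := by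
  have h := (Real.hasDerivAt_cos ((m : ℝ) * k)).comp k ((hasDerivAt_id k).const_mul (m : ℝ))
  have h' : HasDerivAt (fun k => cos ((m : ℝ) * k)) (-sin ((m : ℝ) * k) * ((m : ℝ) * 1)) k := by
    simpa [Function.comp_def] using h
  exact h'.congr_deriv (by ring)

/-- [folklore] -/
theorem hasDerivAt_starK_kx (m n : ℕ) (kx ky : ℝ) :
    HasDerivAt (fun kx => starK m n kx ky) (dstarKx m n kx ky) kx := by
  unfold starK dstarKx
  by_cases hn : n = 0
  · by_cases hm : m = 0
    · simp only [hn, hm, if_true]; exact hasDerivAt_const kx 1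
    · simp only [hn, hm, if_true, if_false]
      exact ((hasDerivAt_cos_natMul m kx).add_const (cos (m * ky))).const_mul 2
  · by_cases hmn : m = n
    · simp only [hn, hmn, if_true, if_false]
      exact ((hasDerivAt_cos_natMul n kx).mul_const (cos (n * ky))).const_mul 4
    · simp only [hn, hmn, if_false]
      exact (((hasDerivAt_cos_natMul m kx).mul_const (cos (n * ky))).add
        ((hasDerivAt_cos_natMul n kx).mul_const (cos (m * ky)))).const_mul 4

/-- **`∂ε/∂kx`** of the shell-list band, harmonic form. [folklore] -/
def ipBandDx (S : List (ℕ × ℕ × ℚ)) (kx ky : ℝ) : ℝ :=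
  (S.map fun s => (s.2.2 : ℝ) * dstarKx s.1 s.2.1 kx ky).sum

/-- [folklore] -/
theorem hasDerivAt_ipBandK_kx' (S : List (ℕ × ℕ × ℚ)) (kx ky : ℝ) :
    HasDerivAt (fun kx => ipBandK S kx ky) (ipBandDx S kx ky) kx := by
  induction S with
  | nil => simp only [ipBandK, ipBandDx, List.map_nil, List.sum_nil]; exact hasDerivAt_const kx (0 : ℝ)
  | cons s S ih =>
    have h := ((hasDerivAt_starK_kx s.1 s.2.1 kx ky).const_mul (s.2.2 : ℝ)).add ih
    simp only [ipBandK, ipBandDx, List.map_cons, List.sum_cons]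
    exact h

/-- The star is symmetric under `kx ↔ ky`. [folklore] -/
theorem starK_comm (m n : ℕ) (kx ky : ℝ) : starK m n kx ky = starK m n ky kx := by
  unfold starK; split_ifs <;> ring

/-- Tetragonal symmetry `ε(kx, ky) = ε(ky, kx)`. [folklore] -/
theorem ipBandK_comm (S : List (ℕ × ℕ × ℚ)) (kx ky : ℝ) : ipBandK S kx ky = ipBandK S ky kx := by
  induction S with
  | nil => simp [ipBandK]
  | cons s S ih =>
    simp only [ipBandK, List.map_cons, List.sum_cons] at ih ⊢
    rw [ih, starK_comm]

/-- **`∂ε/∂ky (kx, ky) = ipBandDx S ky kx`.** [folklore] -/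
theorem hasDerivAt_ipBandK_ky' (S : List (ℕ × ℕ × ℚ)) (kx ky : ℝ) :
    HasDerivAt (fun ky => ipBandK S kx ky) (ipBandDx S ky kx) ky := by
  have hf : (fun ky => ipBandK S kx ky) = fun ky => ipBandK S ky kx := funext fun k => ipBandK_comm S kx k
  rw [hf]; exact hasDerivAt_ipBandK_kx' S ky kx

/-- [folklore] -/
theorem continuous_ipBandK_kx (S : List (ℕ × ℕ × ℚ)) (ky : ℝ) : Continuous (fun kx => ipBandK S kx ky) :=
  continuous_iff_continuousAt.2 fun kx => (hasDerivAt_ipBandK_kx' S kx ky).continuousAt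

/-- [folklore] -/
theorem continuous_ipBandK_ky (S : List (ℕ × ℕ × ℚ)) (kx : ℝ) : Continuous (fun ky => ipBandK S kx ky) :=
  continuous_iff_continuousAt.2 fun ky => (hasDerivAt_ipBandK_ky' S kx ky).continuousAt

/-! ## §2 Integer intervals at a fixed scale -/

/-- `x ∈ [lo, hi]` for integers `lo, hi` (the real `x` is a SCALED quantity). [folklore] -/
def ZEncl (lo hi : ℤ) (x : ℝ) : Prop := (lo : ℝ) ≤ x ∧ x ≤ (hi : ℝ)

/-- [folklore] -/
theorem ZEncl.congr {lo hi : ℤ} {x y : ℝ} (h : ZEncl lo hi x) (e : x = y) : ZEncl lo hi y := e ▸ h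

/-- Moore product, lower end. [cite: Moore1966, §2.2] -/
def zmulLo (a b c d : ℤ) : ℤ := min (min (a * c) (a * d)) (min (b * c) (b * d))

/-- Moore product, upper end. [cite: Moore1966, §2.2] -/
def zmulHi (a b c d : ℤ) : ℤ := max (max (a * c) (a * d)) (max (b * c) (b * d))

/-- **Inclusion property of the integer Moore product.** [cite: Moore1966, Theorem 3.1 / §2.2] -/
theorem zmul_sound {a b c d : ℤ} {x y : ℝ} (hx : ZEncl a b x) (hy : ZEncl c d y) :
    ZEncl (zmulLo a b c d) (zmulHi a b c d) (x * y) := by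
  obtain ⟨ha, hb⟩ := hx
  obtain ⟨hc, hd⟩ := hy
  let I : NonemptyInterval ℝ := ⟨((a : ℝ), (b : ℝ)), ha.trans hb⟩
  let J : NonemptyInterval ℝ := ⟨((c : ℝ), (d : ℝ)), hc.trans hd⟩
  have hxI : x ∈ I := ⟨ha, hb⟩
  have hyJ : y ∈ J := ⟨hc, hd⟩
  have h := NonemptyInterval.mul_mem_mooreMul hxI hyJ
  obtain ⟨h1, h2⟩ : (I.mooreMul J).fst ≤ x * y ∧ x * y ≤ (I.mooreMul J).snd := h
  rw [NonemptyInterval.fst_mooreMul] at h1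
  rw [NonemptyInterval.snd_mooreMul] at h2
  unfold ZEncl zmulLo zmulHi
  constructor
  · push_cast; simpa [I, J] using h1
  · push_cast; simpa [I, J] using h2

/-- Scaling an integer interval by a signed integer constant. [folklore] -/
def zscale (c : ℤ) (I : ℤ × ℤ) : ℤ × ℤ := if 0 ≤ c then (c * I.1, c * I.2) else (c * I.2, c * I.1)

/-- [folklore] -/
theorem zscale_sound (c : ℤ) {I : ℤ × ℤ} {x : ℝ} (hx : ZEncl I.1 I.2 x) :
    ZEncl (zscale c I).1 (zscale c I).2 ((c : ℝ) * x) := by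
  obtain ⟨h1, h2⟩ := hx
  unfold zscale ZEncl
  split_ifs with hc
  · have hc' : (0 : ℝ) ≤ c := by exact_mod_cast hc
    push_cast
    exact ⟨mul_le_mul_of_nonneg_left h1 hc', mul_le_mul_of_nonneg_left h2 hc'⟩
  · have hc' : (c : ℝ) ≤ 0 := by exact_mod_cast (not_le.1 hc).le
    push_cast
    exact ⟨mul_le_mul_of_nonpos_left h2 hc', mul_le_mul_of_nonpos_left h1 hc'⟩

/-- Sum of two integer intervals. [folklore] -/
def zadd (I J : ℤ × ℤ) : ℤ × ℤ := (I.1 + J.1, I.2 + J.2)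

/-- [folklore] -/
theorem zadd_sound {I J : ℤ × ℤ} {x y : ℝ} (hx : ZEncl I.1 I.2 x) (hy : ZEncl J.1 J.2 y) :
    ZEncl (zadd I J).1 (zadd I J).2 (x + y) := by
  obtain ⟨h1, h2⟩ := hx; obtain ⟨h3, h4⟩ := hy
  unfold zadd ZEncl; push_cast; exact ⟨by linarith, by linarith⟩

/-- Moore product of two integer intervals (pair form). [cite: Moore1966, §2.2] -/
def zmulP (I J : ℤ × ℤ) : ℤ × ℤ := (zmulLo I.1 I.2 J.1 J.2, zmulHi I.1 I.2 J.1 J.2)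

/-- [cite: Moore1966, Theorem 3.1 / §2.2] -/
theorem zmulP_sound {I J : ℤ × ℤ} {x y : ℝ} (hx : ZEncl I.1 I.2 x) (hy : ZEncl J.1 J.2 y) :
    ZEncl (zmulP I J).1 (zmulP I J).2 (x * y) := zmul_sound hx hy

/-! ## §3 Harmonic enclosures of the stars, the band and its derivative -/

/-- The four cosine arcs `10⁹·cos(m θ)`, `θ ∈ [k_a, k_b]`, `m = 1 … 4` (computed once per block side). [cite: Moore1966, §3.2] -/
def arcs4 (K : ℕ) (cl ch : ℕ → ℤ) (a b : ℕ) : List (ℤ × ℤ) :=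
  (List.range 4).map fun i => (arcLoZ K cl ((i + 1) * a) ((i + 1) * b), arcHiZ K ch ((i + 1) * a) ((i + 1) * b))

/-- The four sine arcs `10⁹·sin(m θ)` (cosine arcs of the indices shifted by `3K/2`, `K` even). [cite: Moore1966, §3.2] -/
def sarcs4 (K : ℕ) (cl ch : ℕ → ℤ) (a b : ℕ) : List (ℤ × ℤ) :=
  (List.range 4).map fun i =>
    (arcLoZ K cl ((i + 1) * a + 3 * K / 2) ((i + 1) * b + 3 * K / 2),
     arcHiZ K ch ((i + 1) * a + 3 * K / 2) ((i + 1) * b + 3 * K / 2))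

/-- Arc lookup for the harmonic `m`: exact `10⁹` for `m = 0`, the table for `m = 1 … 4`, trivial `[−10⁹, 10⁹]` beyond.
[folklore] -/
def getArc (L : List (ℤ × ℤ)) (m : ℕ) : ℤ × ℤ :=
  if m = 0 then ((cosD : ℤ), (cosD : ℤ)) else L.getD (m - 1) (-(cosD : ℤ), (cosD : ℤ))

/-- Sine-arc lookup: exact `0` for `m = 0`, the table for `m = 1 … 4`, trivial beyond. [folklore] -/
def getSArc (L : List (ℤ × ℤ)) (m : ℕ) : ℤ × ℤ :=
  if m = 0 then (0, 0) else L.getD (m - 1) (-(cosD : ℤ), (cosD : ℤ))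

/-- `L` encloses the cosine harmonics of every `θ ∈ [k_a, k_b]`. [folklore] -/
def CosArcsOK (K : ℕ) (L : List (ℤ × ℤ)) (a b : ℕ) : Prop :=
  ∀ m : ℕ, ∀ θ : ℝ, gridPt K a ≤ θ → θ ≤ gridPt K b → ZEncl (getArc L m).1 (getArc L m).2 ((cosD : ℝ) * cos (m * θ))

/-- `L` encloses the sine harmonics of every `θ ∈ [k_a, k_b]`. [folklore] -/
def SinArcsOK (K : ℕ) (L : List (ℤ × ℤ)) (a b : ℕ) : Prop :=
  ∀ m : ℕ, ∀ θ : ℝ, gridPt K a ≤ θ → θ ≤ gridPt K b → ZEncl (getSArc L m).1 (getSArc L m).2 ((cosD : ℝ) * sin (m * θ))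

/-- `k_{m·a} = m·k_a`. [folklore] -/
theorem gridPt_mul (K m a : ℕ) : gridPt K (m * a) = (m : ℝ) * gridPt K a := by
  unfold gridPt; push_cast; ring

/-- The trivial enclosure `[−10⁹, 10⁹]` of `10⁹·cos` and `10⁹·sin`. [folklore] -/
theorem trivial_cos_encl (x : ℝ) : ZEncl (-(cosD : ℤ)) (cosD : ℤ) ((cosD : ℝ) * cos x) := by
  unfold ZEncl; push_cast
  have hD : (0 : ℝ) ≤ (cosD : ℝ) := by positivity
  exact ⟨by nlinarith [neg_one_le_cos x], by nlinarith [cos_le_one x]⟩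

/-- [folklore] -/
theorem trivial_sin_encl (x : ℝ) : ZEncl (-(cosD : ℤ)) (cosD : ℤ) ((cosD : ℝ) * sin x) := by
  unfold ZEncl; push_cast
  have hD : (0 : ℝ) ≤ (cosD : ℝ) := by positivity
  exact ⟨by nlinarith [neg_one_le_sin x], by nlinarith [sin_le_one x]⟩

/-- **`arcs4` is sound.** [cite: Moore1966, §3.2] -/
theorem arcs4_sound {K : ℕ} (hK : 0 < K) {cl ch : ℕ → ℤ} (hT : CosEnclZ K cl ch) (a b : ℕ) :
    CosArcsOK K (arcs4 K cl ch a b) a b := by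
  intro m θ h1 h2
  unfold getArc
  split_ifs with hm
  · subst hm; unfold ZEncl; simp
  · have key : ∀ i : ℕ, i < 4 → (arcs4 K cl ch a b).getD i (-(cosD : ℤ), (cosD : ℤ)) =
        (arcLoZ K cl ((i + 1) * a) ((i + 1) * b), arcHiZ K ch ((i + 1) * a) ((i + 1) * b)) := by
      intro i hi
      unfold arcs4
      rw [List.getD_eq_getElem?_getD, List.getElem?_map]
      have : (List.range 4)[i]? = some i := by rw [List.getElem?_range hi]
      rw [this]; rfl
    by_cases h4 : m - 1 < 4
    · rw [key (m - 1) h4]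
      have hm1 : m - 1 + 1 = m := by omega
      rw [hm1]
      have hθ1 : gridPt K (m * a) ≤ (m : ℝ) * θ := by
        rw [gridPt_mul]; exact mul_le_mul_of_nonneg_left h1 (by positivity)
      have hθ2 : (m : ℝ) * θ ≤ gridPt K (m * b) := by
        rw [gridPt_mul]; exact mul_le_mul_of_nonneg_left h2 (by positivity)
      exact arc_sound hK hT hθ1 hθ2
    · rw [List.getD_eq_default _ _ (by unfold arcs4; simp; omega)]
      exact trivial_cos_encl _

/-- **`sarcs4` is sound** (`K` even). [cite: Moore1966, §3.2] -/
theorem sarcs4_sound {K : ℕ} (hK : 0 < K) (hev : K % 2 = 0) {cl ch : ℕ → ℤ} (hT : CosEnclZ K cl ch) (a b : ℕ) :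
    SinArcsOK K (sarcs4 K cl ch a b) a b := by
  intro m θ h1 h2
  unfold getSArc
  split_ifs with hm
  · subst hm; unfold ZEncl; simp
  · have key : ∀ i : ℕ, i < 4 → (sarcs4 K cl ch a b).getD i (-(cosD : ℤ), (cosD : ℤ)) =
        (arcLoZ K cl ((i + 1) * a + 3 * K / 2) ((i + 1) * b + 3 * K / 2),
         arcHiZ K ch ((i + 1) * a + 3 * K / 2) ((i + 1) * b + 3 * K / 2)) := by
      intro i hi
      unfold sarcs4
      rw [List.getD_eq_getElem?_getD, List.getElem?_map]
      have : (List.range 4)[i]? = some i := by rw [List.getElem?_range hi]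
      rw [this]; rfl
    by_cases h4 : m - 1 < 4
    · rw [key (m - 1) h4]
      have hm1 : m - 1 + 1 = m := by omega
      rw [hm1]
      have hθ1 : gridPt K (m * a) ≤ (m : ℝ) * θ := by
        rw [gridPt_mul]; exact mul_le_mul_of_nonneg_left h1 (by positivity)
      have hθ2 : (m : ℝ) * θ ≤ gridPt K (m * b) := by
        rw [gridPt_mul]; exact mul_le_mul_of_nonneg_left h2 (by positivity)
      exact sinArc_sound hK hev hT hθ1 hθ2
    · rw [List.getD_eq_default _ _ (by unfold sarcs4; simp; omega)]
      exact trivial_sin_encl _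

/-- Harmonic enclosure of `10¹⁸·star_{(m,n)}(kx, ky)` from the cosine arcs of `kx` (`CX`) and `ky` (`CY`). [cite: Moore1966, Theorem 3.1] -/
def starEnclZ (m n : ℕ) (CX CY : List (ℤ × ℤ)) : ℤ × ℤ :=
  if n = 0 then
    (if m = 0 then ((cosD : ℤ) * (cosD : ℤ), (cosD : ℤ) * (cosD : ℤ))
     else zscale (2 * (cosD : ℤ)) (zadd (getArc CX m) (getArc CY m)))
  else if m = n then zscale 4 (zmulP (getArc CX m) (getArc CY m))
  else zscale 4 (zadd (zmulP (getArc CX m) (getArc CY n)) (zmulP (getArc CX n) (getArc CY m)))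

/-- Harmonic enclosure of `10¹⁸·∂star_{(m,n)}/∂kx` from the sine arcs of `kx` (`SX`) and the cosine arcs of `ky` (`CY`).
[cite: Moore1966, Theorem 3.1] -/
def dstarEnclZ (m n : ℕ) (SX CY : List (ℤ × ℤ)) : ℤ × ℤ :=
  if n = 0 then
    (if m = 0 then (0, 0) else zscale (-(2 * (m : ℤ) * (cosD : ℤ))) (getSArc SX m))
  else if m = n then zscale (-(4 * (m : ℤ))) (zmulP (getSArc SX m) (getArc CY m))
  else zscale (-4) (zadd (zscale (m : ℤ) (zmulP (getSArc SX m) (getArc CY n)))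
    (zscale (n : ℤ) (zmulP (getSArc SX n) (getArc CY m))))

/-- **Soundness of the star enclosure.** [cite: Moore1966, Theorem 3.1] -/
theorem starEnclZ_sound {K : ℕ} {CX CY : List (ℤ × ℤ)} {a0 a1 b0 b1 : ℕ} (hX : CosArcsOK K CX a0 a1)
    (hY : CosArcsOK K CY b0 b1) (m n : ℕ) {kx ky : ℝ} (hx1 : gridPt K a0 ≤ kx) (hx2 : kx ≤ gridPt K a1)
    (hy1 : gridPt K b0 ≤ ky) (hy2 : ky ≤ gridPt K b1) :
    ZEncl (starEnclZ m n CX CY).1 (starEnclZ m n CX CY).2 (((cosD : ℝ) * (cosD : ℝ)) * starK m n kx ky) := by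
  have cx := fun j => hX j kx hx1 hx2
  have cy := fun j => hY j ky hy1 hy2
  unfold starEnclZ starK
  by_cases hn : n = 0
  · by_cases hm : m = 0
    · simp only [hn, hm, if_true]; unfold ZEncl; push_cast; constructor <;> nlinarith
    · simp only [hn, hm, if_true, if_false]
      have h := zscale_sound (2 * (cosD : ℤ)) (zadd_sound (cx m) (cy m))
      exact h.congr (by push_cast; ring)
  · by_cases hmn : m = n
    · simp only [hn, hmn, if_true, if_false]
      have h := zscale_sound 4 (zmulP_sound (cx n) (cy n))
      exact h.congr (by push_cast; ring)
    · simp only [hn, hmn, if_false]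
      have h := zscale_sound 4 (zadd_sound (zmulP_sound (cx m) (cy n)) (zmulP_sound (cx n) (cy m)))
      exact h.congr (by push_cast; ring)

/-- **Soundness of the derivative-star enclosure.** [cite: Moore1966, Theorem 3.1] -/
theorem dstarEnclZ_sound {K : ℕ} {SX CY : List (ℤ × ℤ)} {a0 a1 b0 b1 : ℕ} (hX : SinArcsOK K SX a0 a1)
    (hY : CosArcsOK K CY b0 b1) (m n : ℕ) {kx ky : ℝ} (hx1 : gridPt K a0 ≤ kx) (hx2 : kx ≤ gridPt K a1)
    (hy1 : gridPt K b0 ≤ ky) (hy2 : ky ≤ gridPt K b1) :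
    ZEncl (dstarEnclZ m n SX CY).1 (dstarEnclZ m n SX CY).2 (((cosD : ℝ) * (cosD : ℝ)) * dstarKx m n kx ky) := by
  have sx := fun j => hX j kx hx1 hx2
  have cy := fun j => hY j ky hy1 hy2
  unfold dstarEnclZ dstarKx
  by_cases hn : n = 0
  · by_cases hm : m = 0
    · simp only [hn, hm, if_true]; unfold ZEncl; simp
    · simp only [hn, hm, if_true, if_false]
      have h := zscale_sound (-(2 * (m : ℤ) * (cosD : ℤ))) (sx m)
      exact h.congr (by push_cast; ring)
  · by_cases hmn : m = n
    · simp only [hn, hmn, if_true, if_false]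
      have h := zscale_sound (-(4 * (n : ℤ))) (zmulP_sound (sx n) (cy n))
      exact h.congr (by push_cast; ring)
    · simp only [hn, hmn, if_false]
      have h := zscale_sound (-4) (zadd_sound (zscale_sound (m : ℤ) (zmulP_sound (sx m) (cy n)))
        (zscale_sound (n : ℤ) (zmulP_sound (sx n) (cy m))))
      exact h.congr (by push_cast; ring)


/-- The amplitude scale `10⁶` (amplitudes are transcribed to `1 μeV`). [folklore] -/
def hH : ℕ := 1000000

/-- Integer amplitude `10⁶·h` (meaningful when `10⁶·h` is an integer, `hZOK`). [folklore] -/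
def hZ (h : ℚ) : ℤ := (h * (hH : ℚ)).num

/-- Every amplitude of the shell list is a multiple of `10⁻⁶`. [folklore] -/
def hZOK (S : List (ℕ × ℕ × ℚ)) : Bool := S.all fun s => (s.2.2 * (hH : ℚ)).den == 1

/-- [folklore] -/
theorem cast_hZ {h : ℚ} (hd : (h * (hH : ℚ)).den = 1) : ((hZ h : ℤ) : ℝ) = (hH : ℝ) * (h : ℝ) := by
  have h1 : ((hZ h : ℤ) : ℚ) = h * (hH : ℚ) := by
    unfold hZ; exact Rat.coe_int_num_of_den_eq_one hd
  have h2 := congrArg (fun q : ℚ => (q : ℝ)) h1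
  simp only [Rat.cast_intCast, Rat.cast_mul, Rat.cast_natCast] at h2
  rw [h2]; ring

/-- HARMONIC BLOCK ENCLOSURE of `10¹⁸·10⁶·ε` from the cosine arcs of `kx` and `ky`. [cite: Moore1966, Theorem 3.1] -/
def bandEnclZ (S : List (ℕ × ℕ × ℚ)) (CX CY : List (ℤ × ℤ)) : ℤ × ℤ :=
  S.foldr (fun s acc => zadd (zscale (hZ s.2.2) (starEnclZ s.1 s.2.1 CX CY)) acc) (0, 0)

/-- HARMONIC BLOCK ENCLOSURE of `10¹⁸·10⁶·∂ε/∂kx` from the sine arcs of `kx` and the cosine arcs of `ky`.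
[cite: Moore1966, Theorem 3.1] -/
def dbandEnclZ (S : List (ℕ × ℕ × ℚ)) (SX CY : List (ℤ × ℤ)) : ℤ × ℤ :=
  S.foldr (fun s acc => zadd (zscale (hZ s.2.2) (dstarEnclZ s.1 s.2.1 SX CY)) acc) (0, 0)

/-- The band scale `10⁹·10⁹·10⁶`. [folklore] -/
def bandScale : ℝ := (cosD : ℝ) * (cosD : ℝ) * (hH : ℝ)

/-- **Soundness of the harmonic band enclosure.** [cite: Moore1966, Theorem 3.1] -/
theorem bandEnclZ_sound {K : ℕ} {CX CY : List (ℤ × ℤ)} {a0 a1 b0 b1 : ℕ} (hX : CosArcsOK K CX a0 a1)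
    (hY : CosArcsOK K CY b0 b1) {S : List (ℕ × ℕ × ℚ)} (hS : hZOK S = true) {kx ky : ℝ}
    (hx1 : gridPt K a0 ≤ kx) (hx2 : kx ≤ gridPt K a1) (hy1 : gridPt K b0 ≤ ky) (hy2 : ky ≤ gridPt K b1) :
    ZEncl (bandEnclZ S CX CY).1 (bandEnclZ S CX CY).2 (bandScale * ipBandK S kx ky) := by
  induction S with
  | nil => simp only [bandEnclZ, List.foldr_nil, ipBandK, List.map_nil, List.sum_nil, mul_zero]; unfold ZEncl; simp
  | cons s S ih =>
    simp only [hZOK, List.all_cons, Bool.and_eq_true, beq_iff_eq] at hS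
    have ih' := ih (by simpa [hZOK] using hS.2)
    have hs := zscale_sound (hZ s.2.2) (starEnclZ_sound hX hY s.1 s.2.1 hx1 hx2 hy1 hy2)
    have h := zadd_sound hs ih'
    simp only [bandEnclZ, List.foldr_cons, ipBandK, List.map_cons, List.sum_cons] at h ⊢
    refine h.congr ?_
    rw [cast_hZ hS.1]; unfold bandScale; ring

/-- **Soundness of the harmonic derivative enclosure.** [cite: Moore1966, Theorem 3.1] -/
theorem dbandEnclZ_sound {K : ℕ} {SX CY : List (ℤ × ℤ)} {a0 a1 b0 b1 : ℕ} (hX : SinArcsOK K SX a0 a1)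
    (hY : CosArcsOK K CY b0 b1) {S : List (ℕ × ℕ × ℚ)} (hS : hZOK S = true) {kx ky : ℝ}
    (hx1 : gridPt K a0 ≤ kx) (hx2 : kx ≤ gridPt K a1) (hy1 : gridPt K b0 ≤ ky) (hy2 : ky ≤ gridPt K b1) :
    ZEncl (dbandEnclZ S SX CY).1 (dbandEnclZ S SX CY).2 (bandScale * ipBandDx S kx ky) := by
  induction S with
  | nil => simp only [dbandEnclZ, List.foldr_nil, ipBandDx, List.map_nil, List.sum_nil, mul_zero]; unfold ZEncl; simp
  | cons s S ih =>
    simp only [hZOK, List.all_cons, Bool.and_eq_true, beq_iff_eq] at hS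
    have ih' := ih (by simpa [hZOK] using hS.2)
    have hs := zscale_sound (hZ s.2.2) (dstarEnclZ_sound hX hY s.1 s.2.1 hx1 hx2 hy1 hy2)
    have h := zadd_sound hs ih'
    simp only [dbandEnclZ, List.foldr_cons, ipBandDx, List.map_cons, List.sum_cons] at h ⊢
    refine h.congr ?_
    rw [cast_hZ hS.1]; unfold bandScale; ring

end Summit.Ventures.CertifiedManyBodySolver.Downfold.Emery
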